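import Summits.QuantumFields.YangMills.Theorems.AllWindowsColdBoxBulkMidTiltedMeanDerivative
import HarnessLib

/-!
# Tilt/response calculus (exponential tilting of bounded observables): the third derivative of a tilted mean is the fourth
# joint cumulant; the symmetric difference quotient recovers the covariance up to `(M/6)σ₀²`

Free-hands helper (pure probability, `G`-free) for the crux ⟨stmt-QuantumFields-24006⟩ `AllWindowsColdBox.BulkMidWindowSU2`
(LINE-18 v5, stubs S6/S7), part 2/2: the content of piece **P3 `TiltResponseCalculus`** of the crux idea «fluctuation-response»
(`Cruxes/BulkMidWindowSU2/FluctuationResponseSketch.lean`, crux-ideate seat 1, 2026-08-30), by which the TWO-point expansion S7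
is read off the ONE-point expansion of the one-plaquette-modulated kernel through a symmetric difference quotient in the
modulation parameter.

For a probability measure `μ`, bounded measurable `X, Y` and `μ_σ = μ.tilted (σ·Y)`, with part 1's
`d/dσ E_{μ_σ}[W] = Cov_{μ_σ}(W, Y)`:
* `integral_centred_one_one`, `integral_centred_sq`, `integral_centred_one_three` — the centred moments in raw moments;
* iterating the product rule, the second derivative of `g(σ) = E_{μ_σ}[X]` is the third joint cumulant and the third is the
  fourth joint cumulant `κ₄^{μ_σ}(X; Y, Y, Y) = E[X̃Ỹ³] − 3E[X̃Ỹ]E[Ỹ²]` (inside `tiltResponse_symmDiff_sub_cov_le`);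
* `tiltResponse_symmDiff_sub_cov_le` — if `|κ₄^{μ_σ}(X;Y,Y,Y)| ≤ M` for `|σ| ≤ σ₀` then
  `|(g(σ₀) − g(−σ₀))/(2σ₀) − Cov_μ(X,Y)| ≤ (M/6)σ₀²` (three fencing steps on `g(σ) − g(−σ) − 2σ g'(0)`).
The last statement is, word for word, the body of the sketch's `TiltResponseCalculus` with its `jointCum4` unfolded, so
`theorem tiltResponseCalculus_holds : TiltResponseCalculus := fun Ω _ μ _ X Y B σ₀ M => tiltResponse_symmDiff_sub_cov_le μ X Y B σ₀ M`
is a one-liner wherever that `def` is in scope.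

HONEST LABEL: elementary probability; a would-be piece of an UN-TRIAGED crux idea, landed as a helper (`--supports 24006`);
no stub of LINE-18, no crux, rung or summit is proved; the Yang–Mills mass gap is NOT proved. [folklore]
-/

noncomputable section

open MeasureTheory Real Set Filter Topology

namespace Summit.QuantumFields.YangMills.Theorems.TiltedCumulant

variable {Ω : Type*} [MeasurableSpace Ω]

/-! ## §4 Products of bounded observables; the centred-moment expansions -/

section Bounded

variable {X Y : Ω → ℝ} {B : ℝ}

omit [MeasurableSpace Ω] in
/-- `|X·Y| ≤ B²`. -/
theorem abs_mul_le_sq (hXb : ∀ z, |X z| ≤ B) (hYb : ∀ z, |Y z| ≤ B) (z : Ω) : |X z * Y z| ≤ B ^ 2 := by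
  have hB : 0 ≤ B := (abs_nonneg _).trans (hXb z)
  rw [abs_mul, sq]
  exact mul_le_mul (hXb z) (hYb z) (abs_nonneg _) hB

omit [MeasurableSpace Ω] in
/-- `|X·Y·Y| ≤ B³`. -/
theorem abs_mul_mul_le_cube (hXb : ∀ z, |X z| ≤ B) (hYb : ∀ z, |Y z| ≤ B) (z : Ω) :
    |X z * Y z * Y z| ≤ B ^ 3 := by
  have hB : 0 ≤ B := (abs_nonneg _).trans (hXb z)
  rw [abs_mul, pow_succ]
  exact mul_le_mul (abs_mul_le_sq hXb hYb z) (hYb z) (abs_nonneg _) (sq_nonneg _)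

omit [MeasurableSpace Ω] in
/-- `|X·Y·Y·Y| ≤ B⁴`. -/
theorem abs_mul_mul_mul_le_four (hXb : ∀ z, |X z| ≤ B) (hYb : ∀ z, |Y z| ≤ B) (z : Ω) :
    |X z * Y z * Y z * Y z| ≤ B ^ 4 := by
  have hB : 0 ≤ B := (abs_nonneg _).trans (hXb z)
  rw [abs_mul, pow_succ]
  exact mul_le_mul (abs_mul_mul_le_cube hXb hYb z) (hYb z) (abs_nonneg _) (pow_nonneg hB 3)

end Bounded

section Expansion

variable (ν : Measure Ω) [IsProbabilityMeasure ν] {X Y : Ω → ℝ} (hX : Measurable X) (hY : Measurable Y) {B : ℝ}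
  (hXb : ∀ z, |X z| ≤ B) (hYb : ∀ z, |Y z| ≤ B)
include hX hY hXb hYb

/-- Expansion of the centred mixed moment `∫ (X − EX)(Y − EY) = E[XY] − E[X]E[Y]`. -/
theorem integral_centred_one_one :
    ∫ z, (X z - ∫ w, X w ∂ν) * (Y z - ∫ w, Y w ∂ν) ∂ν =
      (∫ z, X z * Y z ∂ν) - (∫ z, X z ∂ν) * (∫ z, Y z ∂ν) := by
  set a := ∫ w, X w ∂ν
  set b := ∫ w, Y w ∂ν
  have iX : Integrable X ν := integrable_of_abs_le ν hX hXb
  have iY : Integrable Y ν := integrable_of_abs_le ν hY hYb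
  have iXY : Integrable (fun z => X z * Y z) ν := integrable_of_abs_le ν (hX.mul hY) (abs_mul_le_sq hXb hYb)
  have hpt : (fun z => (X z - a) * (Y z - b)) = fun z => (X z * Y z - b * X z) - (a * Y z - a * b) := by
    funext z; ring
  rw [hpt, integral_sub (iXY.sub' (iX.const_mul b)) ((iY.const_mul a).sub' (integrable_const _)),
    integral_sub iXY (iX.const_mul b), integral_sub (iY.const_mul a) (integrable_const _),
    integral_const_mul, integral_const_mul, integral_const, probReal_univ, one_smul]
  ring

omit hX hXb in
/-- Expansion of `∫ (Y − EY)² = E[Y²] − (EY)²`. -/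
theorem integral_centred_sq :
    ∫ z, (Y z - ∫ w, Y w ∂ν) ^ 2 ∂ν = (∫ z, Y z * Y z ∂ν) - (∫ z, Y z ∂ν) * (∫ z, Y z ∂ν) := by
  have h := integral_centred_one_one ν hY hY hYb hYb
  have hpt : (fun z => (Y z - ∫ w, Y w ∂ν) ^ 2) = fun z => (Y z - ∫ w, Y w ∂ν) * (Y z - ∫ w, Y w ∂ν) := by
    funext z; ring
  rw [hpt, h]

/-- Expansion of `∫ (X − EX)(Y − EY)³` in raw moments. -/
theorem integral_centred_one_three :
    ∫ z, (X z - ∫ w, X w ∂ν) * (Y z - ∫ w, Y w ∂ν) ^ 3 ∂ν =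
      (∫ z, X z * Y z * Y z * Y z ∂ν) - 3 * (∫ z, Y z ∂ν) * (∫ z, X z * Y z * Y z ∂ν)
        + 3 * (∫ z, Y z ∂ν) ^ 2 * (∫ z, X z * Y z ∂ν) - (∫ z, Y z ∂ν) ^ 3 * (∫ z, X z ∂ν)
        - (∫ z, X z ∂ν) * (∫ z, Y z * Y z * Y z ∂ν) + 3 * (∫ z, X z ∂ν) * (∫ z, Y z ∂ν) * (∫ z, Y z * Y z ∂ν)
        - 2 * (∫ z, X z ∂ν) * (∫ z, Y z ∂ν) ^ 3 := by
  set a := ∫ w, X w ∂ν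
  set b := ∫ w, Y w ∂ν
  have iX : Integrable X ν := integrable_of_abs_le ν hX hXb
  have iY : Integrable Y ν := integrable_of_abs_le ν hY hYb
  have iXY : Integrable (fun z => X z * Y z) ν := integrable_of_abs_le ν (hX.mul hY) (abs_mul_le_sq hXb hYb)
  have iYY : Integrable (fun z => Y z * Y z) ν := integrable_of_abs_le ν (hY.mul hY) (abs_mul_le_sq hYb hYb)
  have iXYY : Integrable (fun z => X z * Y z * Y z) ν :=
    integrable_of_abs_le ν ((hX.mul hY).mul hY) (abs_mul_mul_le_cube hXb hYb)
  have iYYY : Integrable (fun z => Y z * Y z * Y z) ν :=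
    integrable_of_abs_le ν ((hY.mul hY).mul hY) (abs_mul_mul_le_cube hYb hYb)
  have iXYYY : Integrable (fun z => X z * Y z * Y z * Y z) ν :=
    integrable_of_abs_le ν (((hX.mul hY).mul hY).mul hY) (abs_mul_mul_mul_le_four hXb hYb)
  have hpt : (fun z => (X z - a) * (Y z - b) ^ 3) = fun z =>
      ((X z * Y z * Y z * Y z - 3 * b * (X z * Y z * Y z)) + (3 * b ^ 2 * (X z * Y z) - b ^ 3 * X z)) -
      ((a * (Y z * Y z * Y z) - 3 * a * b * (Y z * Y z)) + (3 * a * b ^ 2 * Y z - a * b ^ 3)) := by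
    funext z; ring
  have i1 : Integrable (fun z => X z * Y z * Y z * Y z - 3 * b * (X z * Y z * Y z)) ν := iXYYY.sub' (iXYY.const_mul _)
  have i2 : Integrable (fun z => 3 * b ^ 2 * (X z * Y z) - b ^ 3 * X z) ν := (iXY.const_mul _).sub' (iX.const_mul _)
  have i3 : Integrable (fun z => a * (Y z * Y z * Y z) - 3 * a * b * (Y z * Y z)) ν :=
    (iYYY.const_mul _).sub' (iYY.const_mul _)
  have i4 : Integrable (fun z => 3 * a * b ^ 2 * Y z - a * b ^ 3) ν := (iY.const_mul _).sub' (integrable_const _)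
  have i12 : Integrable (fun z => (X z * Y z * Y z * Y z - 3 * b * (X z * Y z * Y z)) +
      (3 * b ^ 2 * (X z * Y z) - b ^ 3 * X z)) ν := i1.add i2
  have i34 : Integrable (fun z => (a * (Y z * Y z * Y z) - 3 * a * b * (Y z * Y z)) +
      (3 * a * b ^ 2 * Y z - a * b ^ 3)) ν := i3.add i4
  rw [hpt, integral_sub i12 i34, integral_add i1 i2, integral_add i3 i4,
    integral_sub iXYYY (iXYY.const_mul _), integral_sub (iXY.const_mul _) (iX.const_mul _),
    integral_sub (iYYY.const_mul _) (iYY.const_mul _), integral_sub (iY.const_mul _) (integrable_const _),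
    integral_const_mul, integral_const_mul, integral_const_mul, integral_const_mul, integral_const_mul,
    integral_const_mul, integral_const, probReal_univ, one_smul]
  ring

end Expansion

/-! ## §5 The symmetric difference quotient: three fencing steps -/

/-- **Tilt/response calculus** (the content of piece P3 `TiltResponseCalculus` of the crux idea «fluctuation-response» on
⟨stmt-QuantumFields-24006⟩, with its `jointCum4` unfolded).  For bounded measurable `X, Y` on a probability space and the
tilted family `μ_σ = μ.tilted (σ·Y)`: if the fourth joint cumulant `κ₄^{μ_σ}(X; Y, Y, Y) = E[X̃Ỹ³] − 3E[X̃Ỹ]E[Ỹ²]` is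
bounded by `M` for `|σ| ≤ σ₀` (`σ₀ > 0`), then the symmetric difference quotient of `σ ↦ E_{μ_σ}[X]` at step `σ₀`
recovers the covariance: `|(E_{σ₀}[X] − E_{−σ₀}[X])/(2σ₀) − Cov_μ(X, Y)| ≤ (M/6)·σ₀²`.  (The first derivative of the
tilted mean is the covariance, the third is the fourth joint cumulant; three fencing steps on
`g(σ) − g(−σ) − 2σ g'(0)`.) -/
theorem tiltResponse_symmDiff_sub_cov_le (μ : Measure Ω) [IsProbabilityMeasure μ] (X Y : Ω → ℝ) (B σ₀ M : ℝ)
    (hX : Measurable X) (hY : Measurable Y) (hXb : ∀ z, |X z| ≤ B) (hYb : ∀ z, |Y z| ≤ B) (hσ₀ : 0 < σ₀)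
    (hM : ∀ σ : ℝ, |σ| ≤ σ₀ →
      |(∫ z, (X z - ∫ w, X w ∂(μ.tilted fun z => σ * Y z)) *
            (Y z - ∫ w, Y w ∂(μ.tilted fun z => σ * Y z)) ^ 3 ∂(μ.tilted fun z => σ * Y z)) -
          3 * (∫ z, (X z - ∫ w, X w ∂(μ.tilted fun z => σ * Y z)) *
              (Y z - ∫ w, Y w ∂(μ.tilted fun z => σ * Y z)) ∂(μ.tilted fun z => σ * Y z)) *
            (∫ z, (Y z - ∫ w, Y w ∂(μ.tilted fun z => σ * Y z)) ^ 2 ∂(μ.tilted fun z => σ * Y z))| ≤ M) :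
    |((∫ z, X z ∂(μ.tilted fun z => σ₀ * Y z)) - (∫ z, X z ∂(μ.tilted fun z => (-σ₀) * Y z))) / (2 * σ₀) -
        ((∫ z, X z * Y z ∂μ) - (∫ z, X z ∂μ) * (∫ z, Y z ∂μ))| ≤ M / 6 * σ₀ ^ 2 := by
  have hprob : ∀ s, IsProbabilityMeasure (μ.tilted fun z => s * Y z) := fun s =>
    isProbabilityMeasure_tilted_mul μ hY hYb s
  -- measurability and bounds of the monomials
  have mXY : Measurable fun z => X z * Y z := hX.mul hY
  have mYY : Measurable fun z => Y z * Y z := hY.mul hY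
  have mXYY : Measurable fun z => X z * Y z * Y z := (hX.mul hY).mul hY
  have bXY := abs_mul_le_sq hXb hYb
  have bYY := abs_mul_le_sq hYb hYb
  have bXYY := abs_mul_mul_le_cube hXb hYb
  -- the derivative of every tilted monomial mean (§3): `d/ds E_s[W] = E_s[W·Y] − E_s[W]E_s[Y]`
  have DX := fun s => hasDerivAt_tiltedMean μ hX hY hXb hYb s
  have DY := fun s => hasDerivAt_tiltedMean μ hY hY hYb hYb s
  have DXY := fun s => hasDerivAt_tiltedMean μ mXY hY bXY hYb s
  have DYY := fun s => hasDerivAt_tiltedMean μ mYY hY bYY hYb s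
  have DXYY := fun s => hasDerivAt_tiltedMean μ mXYY hY bXYY hYb s
  -- g, R1 = g', R2 = g'' and R3 = g''' (product rule)
  set g : ℝ → ℝ := fun s => ∫ z, X z ∂(μ.tilted fun z => s * Y z) with hg
  set R1 : ℝ → ℝ := fun s => (∫ z, X z * Y z ∂(μ.tilted fun z => s * Y z)) -
    (∫ z, X z ∂(μ.tilted fun z => s * Y z)) * (∫ z, Y z ∂(μ.tilted fun z => s * Y z)) with hR1
  have hgd : ∀ s, HasDerivAt g (R1 s) s := fun s => DX s
  set R2 : ℝ → ℝ := fun s =>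
    ((∫ z, X z * Y z * Y z ∂(μ.tilted fun z => s * Y z)) -
        (∫ z, X z * Y z ∂(μ.tilted fun z => s * Y z)) * (∫ z, Y z ∂(μ.tilted fun z => s * Y z))) -
      (((∫ z, X z * Y z ∂(μ.tilted fun z => s * Y z)) -
            (∫ z, X z ∂(μ.tilted fun z => s * Y z)) * (∫ z, Y z ∂(μ.tilted fun z => s * Y z))) *
          (∫ z, Y z ∂(μ.tilted fun z => s * Y z)) +
        (∫ z, X z ∂(μ.tilted fun z => s * Y z)) *
          ((∫ z, Y z * Y z ∂(μ.tilted fun z => s * Y z)) -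
            (∫ z, Y z ∂(μ.tilted fun z => s * Y z)) * (∫ z, Y z ∂(μ.tilted fun z => s * Y z)))) with hR2
  have hR1d : ∀ s, HasDerivAt R1 (R2 s) s := fun s => (DXY s).fun_sub ((DX s).fun_mul (DY s))
  set R3 : ℝ → ℝ := fun s =>
    (∫ z, (X z - ∫ w, X w ∂(μ.tilted fun z => s * Y z)) *
          (Y z - ∫ w, Y w ∂(μ.tilted fun z => s * Y z)) ^ 3 ∂(μ.tilted fun z => s * Y z)) -
        3 * (∫ z, (X z - ∫ w, X w ∂(μ.tilted fun z => s * Y z)) *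
            (Y z - ∫ w, Y w ∂(μ.tilted fun z => s * Y z)) ∂(μ.tilted fun z => s * Y z)) *
          (∫ z, (Y z - ∫ w, Y w ∂(μ.tilted fun z => s * Y z)) ^ 2 ∂(μ.tilted fun z => s * Y z)) with hR3
  have hR2d : ∀ s, HasDerivAt R2 (R3 s) s := fun s => by
    haveI := hprob s
    have h := ((DXYY s).fun_sub ((DXY s).fun_mul (DY s))).fun_sub
      ((((DXY s).fun_sub ((DX s).fun_mul (DY s))).fun_mul (DY s)).fun_add
        ((DX s).fun_mul ((DYY s).fun_sub ((DY s).fun_mul (DY s)))))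
    refine HasDerivAt.congr_deriv h ?_
    simp only [hR3]
    rw [integral_centred_one_three (μ.tilted fun z => s * Y z) hX hY hXb hYb,
      integral_centred_one_one (μ.tilted fun z => s * Y z) hX hY hXb hYb,
      integral_centred_sq (μ.tilted fun z => s * Y z) hY hYb]
    ring
  have hM' : ∀ s, |s| ≤ σ₀ → |R3 s| ≤ M := fun s hs => hM s hs
  -- reflections `s ↦ f(−s)`
  have hneg : ∀ {f f' : ℝ → ℝ}, (∀ s, HasDerivAt f (f' s) s) → ∀ s, HasDerivAt (fun t => f (-t)) (-(f' (-s))) s := by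
    intro f f' hf s
    have h : HasDerivAt (fun t => f (-t)) ((-1 : ℝ) • f' (-s)) s := (hf (-s)).scomp s (hasDerivAt_neg s)
    exact h.congr_deriv (by simp)
  -- STEP 1: ψ₂(s) = R₂(s) − R₂(−s), |ψ₂'| ≤ 2M, ψ₂(0) = 0 ⇒ |ψ₂ s| ≤ 2M s on [0, σ₀]
  set ψ2 : ℝ → ℝ := fun s => R2 s - R2 (-s) with hψ2
  have hψ2d : ∀ s, HasDerivAt ψ2 (R3 s + R3 (-s)) s := fun s => by
    have h := (hR2d s).fun_sub (hneg hR2d s)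
    exact h.congr_deriv (by ring)
  have hψ2b : ∀ s ∈ Icc (0 : ℝ) σ₀, ‖ψ2 s‖ ≤ 2 * M * s := by
    intro s hs
    refine image_norm_le_of_norm_deriv_right_le_deriv_boundary (f := ψ2) (f' := fun s => R3 s + R3 (-s))
      (a := 0) (b := σ₀) (fun s _ => (hψ2d s).continuousAt.continuousWithinAt)
      (fun s _ => (hψ2d s).hasDerivWithinAt) (B := fun s => 2 * M * s) (B' := fun _ => 2 * M) ?_ ?_ ?_ hs
    · have : ψ2 0 = 0 := by simp only [hψ2, neg_zero, sub_self]
      rw [this]; simp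
    · intro x
      simpa using ((hasDerivAt_id x).const_mul (2 * M))
    · intro x hx
      rw [Real.norm_eq_abs]
      have h1 := hM' x (by rw [abs_of_nonneg hx.1]; exact hx.2.le)
      have h2 := hM' (-x) (by rw [abs_neg, abs_of_nonneg hx.1]; exact hx.2.le)
      calc |R3 x + R3 (-x)| ≤ |R3 x| + |R3 (-x)| := abs_add_le _ _
        _ ≤ 2 * M := by linarith
  -- STEP 2: ψ₁(s) = R₁(s) + R₁(−s) − 2R₁(0), ψ₁' = ψ₂, ψ₁(0) = 0 ⇒ |ψ₁ s| ≤ M s²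
  set ψ1 : ℝ → ℝ := fun s => R1 s + R1 (-s) - 2 * R1 0 with hψ1
  have hψ1d : ∀ s, HasDerivAt ψ1 (ψ2 s) s := fun s => by
    have h := ((hR1d s).fun_add (hneg hR1d s)).sub_const (2 * R1 0)
    exact h.congr_deriv (by simp only [hψ2]; ring)
  have hψ1b : ∀ s ∈ Icc (0 : ℝ) σ₀, ‖ψ1 s‖ ≤ M * s ^ 2 := by
    intro s hs
    refine image_norm_le_of_norm_deriv_right_le_deriv_boundary (f := ψ1) (f' := ψ2) (a := 0) (b := σ₀)
      (fun s _ => (hψ1d s).continuousAt.continuousWithinAt) (fun s _ => (hψ1d s).hasDerivWithinAt)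
      (B := fun s => M * s ^ 2) (B' := fun s => 2 * M * s) ?_ ?_ ?_ hs
    · have : ψ1 0 = 0 := by simp only [hψ1, neg_zero]; ring
      rw [this]; simp
    · intro x
      have h := ((hasDerivAt_id x).pow 2).const_mul M
      refine h.congr_deriv ?_
      simp; ring
    · intro x hx
      exact hψ2b x ⟨hx.1, hx.2.le⟩
  -- STEP 3: ψ(s) = g(s) − g(−s) − 2s·R₁(0), ψ' = ψ₁, ψ(0) = 0 ⇒ |ψ s| ≤ M s³/3
  set ψ : ℝ → ℝ := fun s => g s - g (-s) - 2 * s * R1 0 with hψ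
  have hψd : ∀ s, HasDerivAt ψ (ψ1 s) s := fun s => by
    have h3 : HasDerivAt (fun t : ℝ => 2 * t * R1 0) (2 * R1 0) s := by
      have := ((hasDerivAt_id s).const_mul 2).mul_const (R1 0)
      simpa [mul_assoc] using this
    have h := ((hgd s).fun_sub (hneg hgd s)).fun_sub h3
    refine (h.congr_deriv ?_)
    simp only [hψ1]
    ring
  have hψb : ∀ s ∈ Icc (0 : ℝ) σ₀, ‖ψ s‖ ≤ M * s ^ 3 / 3 := by
    intro s hs
    refine image_norm_le_of_norm_deriv_right_le_deriv_boundary (f := ψ) (f' := ψ1) (a := 0) (b := σ₀)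
      (fun s _ => (hψd s).continuousAt.continuousWithinAt) (fun s _ => (hψd s).hasDerivWithinAt)
      (B := fun s => M * s ^ 3 / 3) (B' := fun s => M * s ^ 2) ?_ ?_ ?_ hs
    · have : ψ 0 = 0 := by simp only [hψ, neg_zero, mul_zero, zero_mul, sub_self]
      rw [this]; simp
    · intro x
      have h := (((hasDerivAt_id x).pow 3).const_mul M).div_const 3
      refine h.congr_deriv ?_
      simp; ring
    · intro x hx
      exact hψ1b x ⟨hx.1, hx.2.le⟩
  -- conclusion
  have hfin := hψb σ₀ ⟨hσ₀.le, le_rfl⟩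
  rw [Real.norm_eq_abs] at hfin
  have hR10 : R1 0 = (∫ z, X z * Y z ∂μ) - (∫ z, X z ∂μ) * (∫ z, Y z ∂μ) := by
    simp only [hR1, zero_mul, tilted_const]
  have hquot : ((∫ z, X z ∂(μ.tilted fun z => σ₀ * Y z)) - (∫ z, X z ∂(μ.tilted fun z => (-σ₀) * Y z))) /
        (2 * σ₀) - ((∫ z, X z * Y z ∂μ) - (∫ z, X z ∂μ) * (∫ z, Y z ∂μ)) = ψ σ₀ / (2 * σ₀) := by
    rw [← hR10]
    simp only [hψ, hg, neg_mul]
    field_simp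
  rw [hquot, abs_div, abs_of_pos (by positivity : (0 : ℝ) < 2 * σ₀), div_le_iff₀ (by positivity)]
  calc |ψ σ₀| ≤ M * σ₀ ^ 3 / 3 := hfin
    _ = M / 6 * σ₀ ^ 2 * (2 * σ₀) := by ring

end Summit.QuantumFields.YangMills.Theorems.TiltedCumulant

end
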